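import Summits.NavierStokesRegularity.NavierStokesRegularity.Theorems.TaoForcedUniqueness.Negative.SerrinEnstrophyWeakContinuity

/-!
# KJ-6 (8/9): weak nullity of the concentrating dilates THROUGH `T/2` and the Leray–Hopf PACKAGING `isLerayHopfOn_uW`

Cell `ns-blowup`, seat `ns-blowup-refuter` (g10 blueprint, g11 kernel), KILLSHEET §XXIV rows KJ-6/KJ-7,
part 8/9 of the kernel certificate `¬ Literature.Analysis.FluidPDE.Sohr2001_serrinClass_enstrophyBound(_global)`
(final file `SohrSerrinEnstrophyCountableJunk.lean` in this directory, which carries the full account and the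
classification). LABEL: refuter construction (explicit data + proved lemmas; no named facts, no `sorry`).
WHAT THIS IS NOT: not Navier–Stokes evidence and not a statement about Sohr's printed theorem — a hygiene
refutation of two facts AS TYPED (slice-wise force class `MemLqLp 2 2`, one outer Bochner integral in the
weak form); nothing here mentions the summit.

Content: `U ∈ L^{7/4}` from the decay field (`memLp_profile_74`); the scaling law of `∫ ‖U_c‖^{7/4}` and the
Hölder estimate `|∫⟪U_c, ψ⟫| ≤ c^{-3/14} ‖U‖_{7/4} ‖ψ‖_{7/3} → 0` as `c → ∞` (`tendsto_integral_inner_dilate_atTop`);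
weak continuity of the witness through `T/2` within `(0,T]` and on all of `(0,T]` against every `w ∈ L²`
(`uW_weak_continuousOn`); and the ASSEMBLY `isLerayHopfOn_uW : IsLerayHopfOn T ν f 0 u` from parts 4–8.
-/

noncomputable section

namespace Summit.NavierStokesRegularity.ForcedUniquenessHygiene.KJ6

open MeasureTheory Set Function Filter Topology Metric
open scoped ENNReal NNReal RealInnerProductSpace ContDiff Laplacian
open Literature.Analysis.FluidPDE Literature.Analysis.FunctionSpaces

variable {Pr : Profile} (J : JunkFamily Pr)

section Hyps
variable {P : ℕ → Set ℝ} {ℓ : ℝ → ℕ} {ν T : ℝ}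

/-- Decay `‖U x‖ ≤ C (1+‖x‖²)⁻¹` puts the profile in `L^{7/4}` (`(1+‖x‖²)^{-7/4}` is integrable on
`(EuclideanSpace ℝ (Fin 3))` since `7/2 > 3`, Mathlib `integrable_rpow_neg_one_add_norm_sq`). -/
theorem memLp_profile_74 : MemLp Pr.U (ENNReal.ofReal (7 / 4)) volume := by
  obtain ⟨C, hC⟩ := Pr.decay
  have hmeas : AEStronglyMeasurable Pr.U volume := Pr.smooth.continuous.aestronglyMeasurable
  rw [← integrable_norm_rpow_iff hmeas (ENNReal.ofReal_pos.2 (by norm_num)).ne' ENNReal.ofReal_ne_top,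
    ENNReal.toReal_ofReal (by norm_num : (0 : ℝ) ≤ 7 / 4)]
  have hfin : (Module.finrank ℝ (EuclideanSpace ℝ (Fin 3)) : ℝ) < 7 / 2 := by
    rw [finrank_euclideanSpace_fin]; norm_num
  have hint : Integrable (fun x : (EuclideanSpace ℝ (Fin 3)) => ((1 : ℝ) + ‖x‖ ^ 2) ^ (-(7 / 2 : ℝ) / 2)) volume :=
    integrable_rpow_neg_one_add_norm_sq hfin
  have hpt : ∀ x : (EuclideanSpace ℝ (Fin 3)),
      ‖Pr.U x‖ ^ (7 / 4 : ℝ) ≤ |C| ^ (7 / 4 : ℝ) * ((1 : ℝ) + ‖x‖ ^ 2) ^ (-(7 / 2 : ℝ) / 2) := by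
    intro x
    have ha : 0 < (1 : ℝ) + ‖x‖ ^ 2 := by positivity
    have h1 : ‖Pr.U x‖ ≤ |C| * ((1 : ℝ) + ‖x‖ ^ 2)⁻¹ :=
      (hC x).trans (mul_le_mul_of_nonneg_right (le_abs_self C) (inv_nonneg.2 ha.le))
    have h2 : ((1 : ℝ) + ‖x‖ ^ 2) ^ (-(7 / 2 : ℝ) / 2) = (((1 : ℝ) + ‖x‖ ^ 2)⁻¹) ^ (7 / 4 : ℝ) := by
      rw [Real.inv_rpow ha.le, ← Real.rpow_neg ha.le]; norm_num
    rw [h2, ← Real.mul_rpow (abs_nonneg C) (inv_nonneg.2 ha.le)]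
    exact Real.rpow_le_rpow (norm_nonneg _) h1 (by norm_num)
  have hcont : Continuous fun x : (EuclideanSpace ℝ (Fin 3)) => ‖Pr.U x‖ ^ (7 / 4 : ℝ) :=
    (continuous_norm.comp Pr.smooth.continuous).rpow_const fun _ => Or.inr (by norm_num)
  refine (hint.const_mul (|C| ^ (7 / 4 : ℝ))).mono' hcont.aestronglyMeasurable
    (Eventually.of_forall fun x => ?_)
  rw [Real.norm_of_nonneg (Real.rpow_nonneg (norm_nonneg _) _)]
  exact hpt x

/-- The rate exponent: `√c · c · (c³)^{-4/7} = c^{-3/14}`. -/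
theorem dilate_rate {c : ℝ} (hc : 0 < c) :
    Real.sqrt c * c * ((c ^ 3)⁻¹) ^ (4 / 7 : ℝ) = c ^ (-(3 / 14 : ℝ)) := by
  have e1 : (c ^ 3)⁻¹ = c ^ (-3 : ℝ) := by
    rw [Real.rpow_neg hc.le, show (3 : ℝ) = ((3 : ℕ) : ℝ) by norm_num, Real.rpow_natCast]
  have e2 : Real.sqrt c * c = c ^ (3 / 2 : ℝ) := by
    rw [Real.sqrt_eq_rpow, ← Real.rpow_add_one hc.ne']; norm_num
  rw [e2, e1, ← Real.rpow_mul hc.le, ← Real.rpow_add hc]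
  norm_num

/-- `‖U_c‖_{7/4} = c^{-3/14} ‖U‖_{7/4}` (`c^{3/2 - 3/p}` with `p = 7/4`). -/
theorem rpow_integral_dilate {c : ℝ} (hc : 0 < c) :
    (∫ x, ‖dilate c Pr.U x‖ ^ (7 / 4 : ℝ)) ^ (1 / (7 / 4 : ℝ)) =
      c ^ (-(3 / 14 : ℝ)) * (∫ x, ‖Pr.U x‖ ^ (7 / 4 : ℝ)) ^ (1 / (7 / 4 : ℝ)) := by
  have h1 : ∀ x, ‖dilate c Pr.U x‖ ^ (7 / 4 : ℝ) =
      (Real.sqrt c * c) ^ (7 / 4 : ℝ) * ‖Pr.U (c • x)‖ ^ (7 / 4 : ℝ) := by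
    intro x
    rw [JunkBuild.dilate_apply, norm_smul, norm_smul, Real.norm_of_nonneg (Real.sqrt_nonneg c),
      Real.norm_of_nonneg hc.le, ← mul_assoc,
      Real.mul_rpow (mul_nonneg (Real.sqrt_nonneg c) hc.le) (norm_nonneg _)]
  have h2 : ∫ x, ‖Pr.U (c • x)‖ ^ (7 / 4 : ℝ) = (c ^ 3)⁻¹ * ∫ x, ‖Pr.U x‖ ^ (7 / 4 : ℝ) := by
    have := Measure.integral_comp_smul_of_nonneg (μ := volume) (fun y => ‖Pr.U y‖ ^ (7 / 4 : ℝ)) c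
      (hR := hc.le)
    simpa [finrank_euclideanSpace_fin] using this
  have hI : 0 ≤ ∫ x, ‖Pr.U x‖ ^ (7 / 4 : ℝ) := integral_nonneg fun x => Real.rpow_nonneg (norm_nonneg _) _
  have hA : 0 ≤ Real.sqrt c * c := mul_nonneg (Real.sqrt_nonneg c) hc.le
  simp_rw [h1]
  rw [integral_const_mul, h2, ← mul_assoc,
    Real.mul_rpow (mul_nonneg (Real.rpow_nonneg hA _) (inv_nonneg.2 (pow_nonneg hc.le 3))) hI,
    Real.mul_rpow (Real.rpow_nonneg hA _) (inv_nonneg.2 (pow_nonneg hc.le 3)),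
    ← Real.rpow_mul hA, show (7 / 4 : ℝ) * (1 / (7 / 4)) = 1 by norm_num, Real.rpow_one,
    show (1 / (7 / 4 : ℝ)) = 4 / 7 by norm_num, dilate_rate hc]

/-- Step (3) of OBLIGATION 3, its KERNEL (a statement about the PROFILE alone): the
concentrating unitary dilates `U_c = c^{3/2} U(c ·)` are weakly null against continuous compactly
supported fields, `∫⟪U_c, ψ⟫ → 0` as `c → ∞` — by Hölder `|∫⟪U_c, ψ⟫| ≤ ‖U_c‖_{7/4} ‖ψ‖_{7/3} =
c^{-3/14} ‖U‖_{7/4} ‖ψ‖_{7/3}` (`rpow_integral_dilate`, `memLp_profile_74` from the decay field;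
compare the `L³` template `tendsto_integral_inner_rescaleData_zero` of
`NSLerayHopfSereginProfileProofs.lean`). -/
theorem tendsto_integral_inner_dilate_atTop (ψ : (EuclideanSpace ℝ (Fin 3)) → (EuclideanSpace ℝ (Fin 3))) (hψ : Continuous ψ)
    (hψc : HasCompactSupport ψ) :
    Tendsto (fun c => ∫ x, ⟪dilate c Pr.U x, ψ x⟫) atTop (𝓝 0) := by
  have hpq : (7 / 4 : ℝ).HolderConjugate (7 / 3) := ⟨by norm_num, by norm_num, by norm_num⟩
  have hU := memLp_profile_74 (Pr := Pr)
  have hψq : MemLp ψ (ENNReal.ofReal (7 / 3)) volume := hψ.memLp_of_hasCompactSupport hψc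
  have hψ2 : MemLp ψ 2 volume := hψ.memLp_of_hasCompactSupport hψc
  set I : ℝ := (∫ x, ‖Pr.U x‖ ^ (7 / 4 : ℝ)) ^ (1 / (7 / 4 : ℝ)) with hI
  set B : ℝ := (∫ x, ‖ψ x‖ ^ (7 / 3 : ℝ)) ^ (1 / (7 / 3 : ℝ)) with hB
  have hbound : ∀ c, 0 < c → ‖∫ x, ⟪dilate c Pr.U x, ψ x⟫‖ ≤ c ^ (-(3 / 14 : ℝ)) * I * B := by
    intro c hc
    have hUc : MemLp (dilate c Pr.U) (ENNReal.ofReal (7 / 4)) volume := by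
      unfold dilate
      exact (memLp_nsRescaleData hU hc.ne').const_smul _
    have hprod : Integrable (fun x => ‖dilate c Pr.U x‖ * ‖ψ x‖) volume :=
      memLp_one_iff_integrable.1 (hψ2.norm.mul (JunkBuild.memLp_dilate (Pr := Pr) c).norm)
    calc ‖∫ x, ⟪dilate c Pr.U x, ψ x⟫‖
        ≤ ∫ x, ‖⟪dilate c Pr.U x, ψ x⟫‖ := norm_integral_le_integral_norm _
      _ ≤ ∫ x, ‖dilate c Pr.U x‖ * ‖ψ x‖ :=
          integral_mono_of_nonneg (Eventually.of_forall fun x => norm_nonneg _) hprod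
            (Eventually.of_forall fun x => norm_inner_le_norm _ _)
      _ ≤ (∫ x, ‖dilate c Pr.U x‖ ^ (7 / 4 : ℝ)) ^ (1 / (7 / 4 : ℝ)) * B :=
          integral_mul_norm_le_Lp_mul_Lq hpq hUc hψq
      _ = c ^ (-(3 / 14 : ℝ)) * I * B := by rw [rpow_integral_dilate (Pr := Pr) hc]
  have h0 : Tendsto (fun c : ℝ => c ^ (-(3 / 14 : ℝ)) * I * B) atTop (𝓝 (0 * I * B)) :=
    ((tendsto_rpow_neg_atTop (by norm_num : (0 : ℝ) < 3 / 14)).mul_const _).mul_const _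
  rw [zero_mul, zero_mul] at h0
  refine squeeze_zero_norm' ?_ h0
  filter_upwards [eventually_gt_atTop (0 : ℝ)] with c hc using hbound c hc

/-- Step (3) of OBLIGATION 3: weak continuity THROUGH the blow-up instant `T/2` within `(0,T]` against a
continuous compactly supported field — from the kernel `tendsto_integral_inner_dilate_atTop` by the
proved reduction `uW_weak_continuousAt_half_of_null` (PROVED). -/
theorem uW_weak_continuousWithinAt_half (hT : 0 < T) (ψ : (EuclideanSpace ℝ (Fin 3)) → (EuclideanSpace ℝ (Fin 3))) (hψ : Continuous ψ)
    (hψc : HasCompactSupport ψ) (hψ2 : MemLp ψ 2 volume) :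
    ContinuousWithinAt (fun t => ∫ x, ⟪uW Pr T t x, ψ x⟫) (Ioc 0 T) (T / 2) := by
  have _ := hT; have _ := hψ2
  exact (uW_weak_continuousAt_half_of_null (Pr := Pr) (T := T) ψ
    (tendsto_integral_inner_dilate_atTop (Pr := Pr) ψ hψ hψc)).continuousWithinAt

/-- Steps (2)–(4) of OBLIGATION 3: weak continuity of the witness against a CONTINUOUS COMPACTLY
SUPPORTED field `ψ` on `(0,T]` — off `T/2` by `uW_weak_continuousAt_of_ne`, through `T/2` by
`uW_weak_continuousWithinAt_half`. -/
theorem uW_weak_continuousOn_cc (hT : 0 < T) (ψ : (EuclideanSpace ℝ (Fin 3)) → (EuclideanSpace ℝ (Fin 3))) (hψ : Continuous ψ)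
    (hψc : HasCompactSupport ψ) (hψ2 : MemLp ψ 2 volume) :
    ContinuousOn (fun t => ∫ x, ⟪uW Pr T t x, ψ x⟫) (Ioc 0 T) := by
  intro t _
  by_cases h : t = T / 2
  · rw [h]
    exact uW_weak_continuousWithinAt_half hT ψ hψ hψc hψ2
  · exact (uW_weak_continuousAt_of_ne h ψ hψ hψc hψ2).continuousWithinAt

/-- OBLIGATION 3 of `isLerayHopfOn_uW`: weak `L²`-continuity of `t ↦ u(t)` on `(0,T]` (step (1)
`uW_weak_continuousOn_of_compactSupport`, steps (2)–(4) `uW_weak_continuousOn_cc`). ROUTE (as executed;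
the alternatives considered are kept for the record):
(1) DENSITY + UNIFORM APPROXIMATION reduce `w ∈ L²` to continuous compactly supported `ψ`:
    `MemLp.exists_hasCompactSupport_eLpNorm_sub_le` (Mathlib `ContinuousMapDense`) gives `ψ` with
    `‖w - ψ‖₂ ≤ ε`; `|⟪u t, w⟫ - ⟪u t, ψ⟫| ≤ ‖u t‖₂ ε ≤ T‖U‖₂ ε` on `(0,T]` (`eLpNorm_uW_two_le`,
    `abs_integral_inner_le_eLpNorm₂`); conclude with `continuousOn_of_uniform_approx_of_continuousOn`
    (Mathlib `UniformApproximation`).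
(2) OFF `T/2`, for such `ψ`: `t ↦ ∫⟪t • U_{λ(t)}, ψ⟫` is continuous at `t₀ ≠ T/2` by
    `continuous_of_dominated`/`continuousAt_of_dominated`: the integrand is jointly continuous
    (`JunkBuild.continuous_dilate₂` + continuity of `λ` at `t₀`, `Real.rpow` of the nonzero base
    `|t - T/2|`), and on `tsupport ψ ⊆ closedBall 0 R`, for `λ(t) ≤ Λ` near `t₀`, it is dominated by
    `Λ^{3/2} · (sup_{closedBall 0 (Λ R)} ‖U‖) · ‖ψ x‖` (continuous `U` is bounded on compacts).
(3) THROUGH `T/2` (`u (T/2) = 0`, `λ(t) → ∞`): WEAK NULLITY OF CONCENTRATING DILATES against `ψ`,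
    `∫⟪U_c, ψ⟫ → 0` as `c → ∞`. CHEAPEST ROUTE (Hölder, the template is
    `tendsto_integral_inner_rescaleData_zero` in `NSLerayHopfSereginProfileProofs.lean`, there for `L³`
    and `c → 0⁺`): `|∫⟪U_c, ψ⟫| = c^{3/2} |∫⟪U(c x), ψ x⟫| ≤ c^{3/2 - 3/p} ‖U‖_p ‖ψ‖_{p'} → 0` with
    `U ∈ L^{7/4}` (`memLp_profile_74`, from the `decay` field of `Profile` via Mathlib
    `integrable_rpow_neg_one_add_norm_sq`).
(4) `λ` is continuous on `{t ≠ T/2}` and `λ(t) → ∞` as `t → T/2` (`lamSq T t = 1 + |t - T/2|^{-1/4}`,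
    `tendsto_rpow_neg_nhdsGT_zero`-type lemma composed with `|t - T/2| → 0⁺` on the punctured
    neighbourhood); `t ↦ t` is a bounded continuous factor on `(0,T]`. -/
theorem uW_weak_continuousOn (hT : 0 < T) (w : (EuclideanSpace ℝ (Fin 3)) → (EuclideanSpace ℝ (Fin 3))) (hw : MemLp w 2 volume) :
    ContinuousOn (fun t => ∫ x, ⟪uW Pr T t x, w x⟫) (Ioc 0 T) :=
  uW_weak_continuousOn_of_compactSupport (fun ψ hψ hψc hψ2 => uW_weak_continuousOn_cc hT ψ hψ hψc hψ2) w hw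

/-- THE LOAD-BEARING STEP: `u` is a typed Leray–Hopf solution with force `f` and datum `0` on `[0,T)`.
ASSEMBLED from the fields above: `memLp`, `energy_bound`, `strong_initial`, the `0⁺` weak limit,
`weak` conjuncts 1–3 and the WHOLE of `weakGrad_energy` (`G = GW = fderiv`, `∫∫‖G‖² < ∞`, both energy
(in)equalities — `uW_energyIneq`), and of `weak_continuous` the density reduction and the continuity
off `T/2` and the weak nullity of the concentrating dilates through `T/2` (`uW_weak_continuousOn`), and the
VOID weak form `uW_weakForm` (conjunct 4 of `weak`).
MAP (field by field of `IsLerayHopfOn` / `IsWeakNSSolutionOn`):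
* `weak`, conjunct 1 (`AEStronglyMeasurable (uncurry u)` on `(0,T) × (EuclideanSpace ℝ (Fin 3))`): `u (t,x) = t λ(t)^{3/2} U(λ(t) x)`
  off `t = T/2`, `λ` measurable (`measurable_lam`), `U` continuous ⇒ jointly measurable.
* `weak`, conjunct 2 (local `L²`): `∫₀ᵀ ‖u t‖₂² = ‖U‖₂² ∫₀ᵀ t² < ∞` (`eLpNorm_dilate_two`).
* `weak`, conjunct 3 (div-free slices): dilates and multiples of `Pr.divFree`.
* `weak`, conjunct 4 (THE WEAK FORM, one outer Bochner integral in `t` of the whole slice integrand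
  `g_ψ(t) = A_ψ(t) + κ(t)⟪U_λ, ψ t⟫ + k (ℓ t) t`, `k m t := ∫⟪Φ (λ t) m, ψ t⟫`, `A_ψ` = the three
  `u`-terms): TWO BRANCHES. (a) `g_ψ` not integrable on `(0,T)` (in particular not a.e.-strongly
  measurable) ⇒ the outer integral is the junk `0` and the identity reads `0 + ∫⟪0, ψ 0⟫ = 0` ✓ (THIS is
  why the datum is `0`). (b) `g_ψ` integrable ⇒ `t ↦ k (ℓ t) t` is a.e.-strongly measurable (the other
  summands are measurable: `J.measurable`, `measurable_lam`) ⇒ `ae_eq_of_aestronglyMeasurable_label`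
  (SaturatedPartition.lean) gives, for every `m`, `k (ℓ t) t = k m t` a.e.; `m = 0` and `J.zero` give
  `k (ℓ t) t = 0` a.e., hence `k m t = 0` a.e. for every `m ≥ 1` ⇒ `J.total`: `ψ t = a(t) • U_{λ(t)}` for
  a.e. `t`; the slice `ψ t` is compactly supported while `U_{λ(t)}` is not (`Pr.far`, dilation) ⇒
  `a(t) = 0`, `ψ t = 0` for a.e. `t ∈ (0,T)`, hence for ALL `t ∈ (0,T)` (`ψ` is jointly continuous) ⇒
  `timeDeriv ψ t = 0` on the open interval, `convect (u t) 0 = 0`, `Δ 0 = 0`, `⟪f, 0⟫ = 0`: the slice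
  integrand vanishes IDENTICALLY on `(0,T)` and the identity reads `0 + ∫⟪0, ψ 0⟫ = 0` ✓ (K54 (4)
  verbatim; in fact (a) needs only «not a.e.-strongly measurable», and (a)/(b) exhaust). REMARK: with a
  COMPACTLY supported profile (the earlier design) branch (b) would instead return the honest
  one-mode tests `ψ t = a(t) • U_{λ(t)}`, `a ∈ C_c^∞((0,T) ∖ {T/2})` arbitrary, whose identity is the
  Galerkin equation `‖U‖₂² ∫ (t a)′ = 0` — true by the choice of `κ`, but 300–400 extra lines across the
  blow-up instant (lit g9, STATUS l.2342 (2)); hence the switch to `swirl`.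
* `energy_bound`, `memLp`: `‖u t‖₂ = t ‖U‖₂` (`eLpNorm_dilate_two`, `memLp_uW_slice`-style).
* `weakGrad_energy`: `G t = fderiv ℝ (u t)` (smooth slices, `hasWeakGradient_fderiv_of_contDiff`);
  `∫₀ᵀ ‖∇u‖₂² = ‖∇U‖₂² ∫ t² λ² < ∞` (`eWeakGradL2Sq_uW`, `integrableOn_lamSq_sq`); BOTH energy
  inequalities hold with EQUALITY: the work term is honest, `∫⟪f τ, u τ⟫ = κ(τ) τ ‖U‖₂²` for EVERY `τ`
  (`J.orth` kills the junk part exactly, no measurability issue), and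
  `½ t² ‖U‖₂² + ν ‖∇U‖₂² ∫ₛᵗ τ² λ² = ½ s² ‖U‖₂² + ∫ₛᵗ κ τ ‖U‖₂²` by the choice of `κ`.
* `weak_continuous`: `t ↦ t ⟪U_{λ(t)}, w⟫` is continuous off `T/2` (dominated convergence) and tends to
  `0 = ⟪u (T/2), w⟫` at `T/2` because `λ(t) → ∞` and unitary dilates of a fixed `L²` profile converge
  weakly to `0` — TWO-STEP for the non-compact `swirl` (lit g9 l.2342 (2)): tail
  `‖U_λ · 𝟙_{‖x‖ > r}‖₂ = ‖U · 𝟙_{‖x‖ > λ r}‖₂ → 0` as `λ → ∞`, then `‖w · 𝟙_{B(0,r)}‖₂ → 0` as `r → 0`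
  (Cauchy–Schwarz on the two pieces); this is the one genuinely analytic lemma of the field. Limit
  `⟪0, w⟫ = 0` at `0⁺` from `‖u t‖₂ = t‖U‖₂`.
* `strong_initial`: `‖u t − 0‖₂ = t ‖U‖₂ → 0`. -/
theorem isLerayHopfOn_uW (hP : ∀ m (F : Set ℝ), MeasurableSet F → F ⊆ (P m)ᶜ → volume F = 0)
    (hℓ : ∀ t, t ∈ P (ℓ t)) (hℓ' : ∀ m, ∀ t ∈ P m, ℓ t = m) (hν : 0 < ν) (hT : 0 < T) :
    IsLerayHopfOn T ν (fW J ℓ ν T) 0 (uW Pr T) :=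
  { weak := uW_weak J hP hℓ hℓ' hν hT
    energy_bound := uW_energy_bound T
    memLp := uW_memLp_field T
    weakGrad_energy := uW_weakGrad_energy J ℓ hν hT
    weak_continuous := fun w hw => ⟨uW_weak_continuousOn hT w hw, uW_weak_initial T w hw⟩
    strong_initial := uW_strong_initial T }

end Hyps

end Summit.NavierStokesRegularity.ForcedUniquenessHygiene.KJ6
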